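import Literature.AlgebraicGeometry.GroupSchemes.ImageCokernelFlat
import Literature.AlgebraicGeometry.GroupSchemes.IdempotentSplittingFiniteFlat
import HarnessLib

/-!
# The kernel of the layer map is the `𝔭`-block of the kernel: `Ker (φ : A[𝔭] → B[𝔭]) ≅ (Ker ψ)[𝔭] = Fix (β e)`, a direct factor — hence flat
# ([Tate 1997] (1.6)–(1.7), (3.7); [Tate 1967] §2.2; [GW I] Def. 4.45 (2); [EGA IV₂] 2.8.5)

Topic `Literature/AlgebraicGeometry/GroupSchemes`; namespace `Literature.AlgebraicGeometry.GroupSchemes.LayerMapKernel` (continues ★ `LayerMapKernel`, p847980).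
THEOREMS ONLY (no definition, no instance, no notation, no named fact, no `sorry`).  Cell `hodgecm-mathlib` (D-0151), programme P6 «MOD» (crux hLiu418 =
stmt-HodgeConjecture-24832, `--supports`, count-neutral): organ **(F-blk) «KERNEL OF THE LAYER MAP = `𝔭`-BLOCK OF THE KERNEL»** of the FLATNESS-INPUT road of line
L2 ∕ socket `stub_DOWN` (LA2-p04 (g0), census 2026-09-02T02:41Z).  WHY: at the `𝒪_Ω̄`-point of (O1) `stub_SPEC` the upstairs isogeny is the ROOF `q : A_y → B`
(★ `RoofΩ` (r1)): its kernel `K` is NOT inside the `c•w`-layer — only `K ∩ A_y[𝔭_{c•w}] = L` (`RoofLink`) — so the pin door ★ `exists_kerIso_of_pin` (`Ker ψ ≤ A[𝔭]`)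
does not fire on `q` itself; but `K` is killed by `𝔭_{c•w}·𝔠` with `𝔭_{c•w} + 𝔠 = 𝒪` (`K ≤ A[p]`, `p` unramified at `c•w`), and then the kernel of the layer map IS
the `𝔭_{c•w}`-BLOCK of `Ker q`, a direct factor of a finite flat group scheme.  With ★ p847980 §3 and ★ p848077 §3 this gives the (O-K) ED. 2 and (SP-img)
§3 flatness instances for the roof as typed.  HC_CM is proved only modulo the printed citations until rung 0 closes; this file is generic and changes no count.

THE MATHEMATICS.  Over a base scheme `S` let `ψ : A → B` be a homomorphism of group schemes, `K = Ker ψ ↪ A`, `α : O → End A` a ring acting (`α(ab) =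
α(b)∘…` in the ★ `RingAction` convention, additive, unital) such that `α` preserves `K` (`(ι_K ≫ α a) ≫ ψ = 1`, e.g. `ψ` equivariant), so that `O` acts on `K` by
`β_K` (`β_K a ≫ ι_K = ι_K ≫ α a`).  Let `𝔭 ⊆ O` and `e ∈ O` with `e ≡ 1 (mod 𝔭)` and `𝔭·e` KILLING `K` (a CRT idempotent modulo an ideal `𝔭𝔠 ∋` the
exponent of `K`, `𝔭 + 𝔠 = O`; [Tate1967] §2.2).  Then for a `T`-point `s` of `K`: `s` is `𝔭`-torsion (`ι_K s` killed by `α(𝔭)`) iff `s ≫ β_K e = s` (§1):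
«⇐» `ι_K s ≫ α a = ι_K (s ≫ β_K e ≫ β_K a) = ι_K (s ≫ β_K(ae)) = 1`; «⇒» `s ≫ β_K e = s ≫ β_K(e − 1) · s ≫ β_K 1 = 1 · s`.  In particular `β_K e` is
idempotent (`e² = e + (e−1)e`).  Now let `ιA : A[𝔭] ↪ A`, `ιB : B[𝔭] ↪ B` be pins (kernel-of-`𝔭` universal property on `T`-points) and `φ : A[𝔭] → B[𝔭]` the
layer map of `ψ` (`φ ≫ ιB = ιA ≫ ψ`).  By ★ `exists_comp_kerι_eq_iff` the `T`-points of `Ker φ` are the `𝔭`-torsion points of `A` killed by `ψ`, i.e. the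
`𝔭`-torsion points of `K`, i.e. the points of `Fix(β_K e) ↪ K` (★ `IdempotentSplitting.exists_comp_fixι_eq_iff`); so `Ker φ ≅ Fix(β_K e)` over `A` (§2), and
`Fix` of an idempotent is a retract: `Ker φ → S` is flat (finite) when `K → S` is (★ `IdempotentSplitting.flat_fix_hom`; [EGAIV2] 2.8.5) (§3).  Over `Spec R`
with affine carriers this discharges `[Module.Flat R (Γ(A[𝔭]) ⧸ J(φ))]` (★ p847980) and, for `R` local with `Γ(A[𝔭])` finite free, `[Module.Flat R (Γ(A[𝔭]) ⧸ im Γ(φ))]`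
(★ p848077) (§4).

## Contents
* §1 (`Over S`) `exists_kerAction` (the action on `Ker ψ`), `kerAction_comp_eq_one_of`, `kerAction_idem` (`β_K e` is idempotent),
  **`comp_kerAction_eq_self_iff`** (`s ≫ β_K e = s ↔ ι_K s` is `𝔭`-torsion).
* §2 **`exists_kerIso_fix`** — `Ker φ ≅ Fix (β_K e)` over `A`.
* §3 **`flat_ker_hom_of_block`**, **`isFinite_ker_hom_of_block`** — `[Flat (Ker ψ → S)] ⇒ Flat (Ker φ → S)`, same for finite.
* §4 (`Spec R`, affine) HEADS **`flat_quotient_map_ker_counit_of_block`** (the ★ (O-K) ED. 2 instance) and **`flat_quotient_range_comap_of_block`** (the ★ (SP-img) §3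
  instance, `R` local, `Γ(A[𝔭])` finite free).

## References
* [Tate1997FiniteFlatGroupSchemes] J. Tate, *Finite flat group schemes* (1997), (1.6)–(1.7) p. 122, (3.7) p. 146.
* [Tate1967] J. T. Tate, *p-divisible groups*, Proc. Conf. Local Fields (Driebergen 1966), Springer 1967, §2.2.
* [GortzWedhorn2020] U. Görtz, T. Wedhorn, *Algebraic Geometry I: Schemes*, 2nd ed. (2020), Definition 4.45 (2) p. 117.
* [EGAIV2] A. Grothendieck, J. Dieudonné, *ÉGA* IV₂, Publ. Math. IHÉS 24 (1965), Prop. 2.8.5.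
* [AtiyahMacdonald1969] M. F. Atiyah, I. G. Macdonald, *Introduction to Commutative Algebra* (1969), Ch. 2 Exercise 4 (p. 31) (direct summands of flat modules).
-/

set_option autoImplicit false

-- Mathlib's `Over`/`Scheme` APIs are stated across semireducible wrappers (as in the ★ `GroupSchemes/*` files).
set_option backward.isDefEq.respectTransparency false

universe u

open CategoryTheory CategoryTheory.Limits MonoidalCategory CartesianMonoidalCategory AlgebraicGeometry

noncomputable section

namespace Literature.AlgebraicGeometry.GroupSchemes.LayerMapKernel

open scoped MonObj

open GroupSchemeKernel IdealKernelLayerMap IdempotentSplitting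

/-! ## §1 The action on `Ker ψ` and the `𝔭`-torsion test `s ≫ β_K e = s` -/

section Action

variable {S : Scheme.{u}} {A B : Over S} [GrpObj A] [GrpObj B] (ψ : A ⟶ B) [IsMonHom ψ] {O : Type*} (α : O → (A ⟶ A))

omit [GrpObj A] [IsMonHom ψ] in
/-- **THE ACTION ON THE KERNEL**: if `α a` preserves `Ker ψ` (`(ι_K ≫ α a) ≫ ψ = 1`, e.g. `ψ` equivariant) then `O` acts on `Ker ψ` by endomorphisms `β_K a` over
`α a` (`β_K a ≫ ι_K = ι_K ≫ α a`; ★ `kerLift`). [cite: Tate1997FiniteFlatGroupSchemes, (1.6)–(1.7) p. 122] [cite: GortzWedhorn2020, Definition 4.45 (2), p. 117] -/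
theorem exists_kerAction (hψ : ∀ a, (kerι ψ ≫ α a) ≫ ψ = 1) :
    ∃ βK : O → (ker ψ ⟶ ker ψ), ∀ a, βK a ≫ kerι ψ = kerι ψ ≫ α a :=
  ⟨fun a => kerLift (kerι ψ ≫ α a) (hψ a), fun _ => kerLift_ι _ _⟩

omit [GrpObj A] [IsMonHom ψ] in
/-- Equivariance supplies the hypothesis of `exists_kerAction`: `α a ≫ ψ = ψ ≫ b` with `b` a homomorphism ⇒ `(ι_K ≫ α a) ≫ ψ = ι_K ≫ ψ ≫ b = 1`.
[cite: Tate1997FiniteFlatGroupSchemes, (1.6)–(1.7) p. 122] -/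
theorem kerι_comp_comp_eq_one_of_equivariant (hequiv : ∀ a, ∃ b : B ⟶ B, IsMonHom b ∧ α a ≫ ψ = ψ ≫ b) (a : O) :
    (kerι ψ ≫ α a) ≫ ψ = 1 := by
  obtain ⟨b, hb, h⟩ := hequiv a
  haveI := hb
  rw [Category.assoc, h, ← Category.assoc, kerι_comp, MonObj.one_comp]

variable {ψ α}

/-- A scalar `c` with `ι_K ≫ α c = 1` acts trivially on `Ker ψ`: `β_K c = 1` (`ι_K` is a mono homomorphism). [cite: Tate1997FiniteFlatGroupSchemes, (1.6)–(1.7) p. 122] -/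
theorem kerAction_eq_one_of {βK : O → (ker ψ ⟶ ker ψ)} (hβK : ∀ a, βK a ≫ kerι ψ = kerι ψ ≫ α a) {c : O} (hc : kerι ψ ≫ α c = 1) :
    βK c = 1 := by
  haveI := mono_kerι ψ
  rw [← cancel_mono (kerι ψ), hβK, hc, MonObj.one_comp]

variable [CommRing O] {σ : Type*} [SetLike σ O]

/-- **`β_K e` IS IDEMPOTENT** when `e - 1 ∈ 𝔭` and `𝔭·e` kills `Ker ψ`: `e·e = e + (e - 1)·e`. [cite: Tate1967, §2.2] [cite: Tate1997FiniteFlatGroupSchemes, (3.7) p. 146] -/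
theorem kerAction_idem (αmul : ∀ a b, α (a * b) = α b ≫ α a) (αadd : ∀ a b, α (a + b) = α a * α b)
    {βK : O → (ker ψ ⟶ ker ψ)} (hβK : ∀ a, βK a ≫ kerι ψ = kerι ψ ≫ α a)
    (𝔭 : σ) {e : O} (he : e - 1 ∈ 𝔭) (hKe : ∀ a ∈ 𝔭, kerι ψ ≫ α (a * e) = 1) :
    βK e ≫ βK e = βK e := by
  haveI := mono_kerι ψ
  have hmul := layerAction_mul α αmul (kerι ψ) βK hβK
  have hadd := layerAction_add α αadd (kerι ψ) βK hβK
  have h1 : βK ((e - 1) * e) = 1 := kerAction_eq_one_of hβK (hKe (e - 1) he)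
  calc βK e ≫ βK e = βK (e * e) := (hmul e e).symm
    _ = βK (e + (e - 1) * e) := by ring_nf
    _ = βK e := by rw [hadd, h1, mul_one]

/-- **THE `𝔭`-TORSION TEST ON `Ker ψ`: `s ≫ β_K e = s` iff `ι_K s` is killed by `α(𝔭)`** (for `e - 1 ∈ 𝔭`, `𝔭·e` killing `Ker ψ`):
«⇐» `ι_K s ≫ α a = ι_K (s ≫ β_K e ≫ β_K a) = ι_K (s ≫ β_K (a e)) = 1`; «⇒» `s ≫ β_K e = (s ≫ β_K (e - 1)) · (s ≫ β_K 1) = 1 · s`.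
[cite: Tate1967, §2.2] [cite: Tate1997FiniteFlatGroupSchemes, (1.6)–(1.7) p. 122, (3.7) p. 146] -/
theorem comp_kerAction_eq_self_iff (α1 : α 1 = 𝟙 A) (αmul : ∀ a b, α (a * b) = α b ≫ α a) (αadd : ∀ a b, α (a + b) = α a * α b)
    {βK : O → (ker ψ ⟶ ker ψ)} (hβK : ∀ a, βK a ≫ kerι ψ = kerι ψ ≫ α a)
    (𝔭 : σ) {e : O} (he : e - 1 ∈ 𝔭) (hKe : ∀ a ∈ 𝔭, kerι ψ ≫ α (a * e) = 1) {T : Over S} (s : T ⟶ ker ψ) :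
    s ≫ βK e = s ↔ ∀ a ∈ 𝔭, (s ≫ kerι ψ) ≫ α a = 1 := by
  haveI := mono_kerι ψ
  have hmul := layerAction_mul α αmul (kerι ψ) βK hβK
  have hadd := layerAction_add α αadd (kerι ψ) βK hβK
  have hone := layerAction_one α α1 (kerι ψ) βK hβK
  constructor
  · intro hs a ha
    have h1 : βK (a * e) = 1 := kerAction_eq_one_of hβK (hKe a ha)
    rw [Category.assoc, ← hβK, ← Category.assoc, ← hs, Category.assoc, Category.assoc, ← Category.assoc (βK e), ← hmul, h1,
      MonObj.one_comp, MonObj.comp_one]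
  · intro hs
    have h1 : s ≫ βK (e - 1) = 1 := by
      rw [← cancel_mono (kerι ψ), Category.assoc, hβK, ← Category.assoc, hs (e - 1) he, MonObj.one_comp]
    calc s ≫ βK e = s ≫ βK ((e - 1) + 1) := by rw [sub_add_cancel]
      _ = s ≫ (βK (e - 1) * βK 1) := by rw [hadd]
      _ = (s ≫ βK (e - 1)) * (s ≫ βK 1) := MonObj.comp_mul _ _ _
      _ = s := by rw [h1, one_mul, hone, Category.comp_id]

end Action

/-! ## §2 `Ker φ ≅ Fix (β_K e)` over `A` -/

section Block

variable {S : Scheme.{u}} {A B GA GB : Over S} [GrpObj A] [GrpObj B] [GrpObj GB] (ψ : A ⟶ B) [IsMonHom ψ]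
  {O : Type*} [CommRing O] {σ : Type*} [SetLike σ O] (𝔭 : σ) (α : O → (A ⟶ A))
  (ιA : GA ⟶ A) [Mono ιA] (ιB : GB ⟶ B) [IsMonHom ιB] [Mono ιB]

/-- **`Ker φ ≅ Fix (β_K e)` OVER `A`**: the `T`-points of the kernel of the layer map `φ` (`φ ≫ ιB = ιA ≫ ψ`) are the `𝔭`-torsion points killed by `ψ` (★
`exists_comp_kerι_eq_iff` + the pin `hkerA`), i.e. the points of `Ker ψ` fixed by `β_K e` (`comp_kerAction_eq_self_iff`, ★ `IdempotentSplitting.exists_comp_fixι_eq_iff`);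
two subobjects of `A` with the same points are isomorphic over `A`. [cite: Tate1997FiniteFlatGroupSchemes, (1.6)–(1.7) p. 122, (3.7) p. 146] [cite: GortzWedhorn2020, Definition 4.45 (2), p. 117] -/
theorem exists_kerIso_fix (α1 : α 1 = 𝟙 A) (αmul : ∀ a b, α (a * b) = α b ≫ α a) (αadd : ∀ a b, α (a + b) = α a * α b)
    (hkerA : ∀ ⦃T : Over S⦄ (t : T ⟶ A), (∀ a ∈ 𝔭, t ≫ α a = 1) ↔ ∃ s : T ⟶ GA, s ≫ ιA = t)
    {φ : GA ⟶ GB} (hφ : φ ≫ ιB = ιA ≫ ψ)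
    {βK : O → (ker ψ ⟶ ker ψ)} (hβK : ∀ a, βK a ≫ kerι ψ = kerι ψ ≫ α a)
    {e : O} (he : e - 1 ∈ 𝔭) (hKe : ∀ a ∈ 𝔭, kerι ψ ≫ α (a * e) = 1) :
    ∃ E : ker φ ≅ fix (βK e), E.hom ≫ fixι (βK e) ≫ kerι ψ = kerι φ ≫ ιA ∧ E.inv ≫ kerι φ ≫ ιA = fixι (βK e) ≫ kerι ψ := by
  haveI := mono_kerι ψ
  haveI := mono_kerι φ
  haveI := mono_fixι (βK e)
  -- `κ : Ker φ → Ker ψ` over `ιA`, fixed by `β_K e`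
  obtain ⟨κ, hκ⟩ := exists_kerHom ιA ιB ψ hφ
  have hκfix : κ ≫ βK e = κ := by
    rw [comp_kerAction_eq_self_iff α1 αmul αadd hβK 𝔭 he hKe]
    intro a ha
    rw [hκ, Category.assoc, comp_eq_one_of_pin 𝔭 α ιA hkerA ha, MonObj.comp_one]
  -- `j : Fix (β_K e) → GA` over `ι_K`, killed by `φ`
  have hfix𝔭 : ∀ a ∈ 𝔭, (fixι (βK e) ≫ kerι ψ) ≫ α a = 1 :=
    (comp_kerAction_eq_self_iff α1 αmul αadd hβK 𝔭 he hKe (fixι (βK e))).mp (fixι_comp (βK e))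
  obtain ⟨j, hj⟩ := (hkerA (fixι (βK e) ≫ kerι ψ)).mp hfix𝔭
  have hjφ : j ≫ φ = 1 := by
    rw [comp_eq_one_iff_of_comp_eq ιA ιB ψ hφ j, ← Category.assoc, hj, Category.assoc, kerι_comp, MonObj.comp_one]
  refine ⟨⟨fixLift (βK e) κ hκfix, kerLift j hjφ, ?_, ?_⟩, ?_, ?_⟩
  · apply ker_hom_ext
    rw [← cancel_mono ιA, Category.assoc, Category.assoc, Category.id_comp, ← Category.assoc (kerLift j hjφ) (kerι φ) ιA, kerLift_ι, hj,
      ← Category.assoc, fixLift_ι, hκ]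
  · apply fix_hom_ext
    rw [← cancel_mono (kerι ψ), Category.assoc, Category.assoc, Category.id_comp, ← Category.assoc (fixLift (βK e) κ hκfix) (fixι (βK e)) (kerι ψ),
      fixLift_ι, hκ, ← Category.assoc, kerLift_ι, hj]
  · show fixLift (βK e) κ hκfix ≫ fixι (βK e) ≫ kerι ψ = kerι φ ≫ ιA
    rw [← Category.assoc, fixLift_ι, hκ]
  · show kerLift j hjφ ≫ kerι φ ≫ ιA = fixι (βK e) ≫ kerι ψ
    rw [← Category.assoc, kerLift_ι, hj]

/-! ## §3 `Ker φ → S` is flat (finite) when `Ker ψ → S` is -/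

/-- **`[Flat (Ker ψ → S)] ⇒ Flat (Ker φ → S)`**: `Ker φ ≅ Fix (β_K e)` is a retract of the flat `Ker ψ` (`β_K e` idempotent, ★ `IdempotentSplitting.flat_fix_hom`).
[cite: EGAIV2, Prop. 2.8.5] [cite: AtiyahMacdonald1969, Ch. 2 Exercise 4 (p. 31)] [cite: Tate1997FiniteFlatGroupSchemes, (3.7) p. 146] -/
theorem flat_ker_hom_of_block (α1 : α 1 = 𝟙 A) (αmul : ∀ a b, α (a * b) = α b ≫ α a) (αadd : ∀ a b, α (a + b) = α a * α b)
    (hkerA : ∀ ⦃T : Over S⦄ (t : T ⟶ A), (∀ a ∈ 𝔭, t ≫ α a = 1) ↔ ∃ s : T ⟶ GA, s ≫ ιA = t)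
    {φ : GA ⟶ GB} (hφ : φ ≫ ιB = ιA ≫ ψ)
    {βK : O → (ker ψ ⟶ ker ψ)} (hβK : ∀ a, βK a ≫ kerι ψ = kerι ψ ≫ α a)
    {e : O} (he : e - 1 ∈ 𝔭) (hKe : ∀ a ∈ 𝔭, kerι ψ ≫ α (a * e) = 1) [Flat (ker ψ).hom] :
    Flat (ker φ).hom := by
  obtain ⟨E, -, -⟩ := exists_kerIso_fix ψ 𝔭 α ιA ιB α1 αmul αadd hkerA hφ hβK he hKe
  haveI := flat_fix_hom (βK e) (kerAction_idem αmul αadd hβK 𝔭 he hKe)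
  exact flat_hom_of_iso E

/-- **`[IsFinite (Ker ψ → S)] ⇒ IsFinite (Ker φ → S)`** (★ `IdempotentSplitting.isFinite_fix_hom`). [cite: Tate1997FiniteFlatGroupSchemes, (3.7) p. 146] -/
theorem isFinite_ker_hom_of_block (α1 : α 1 = 𝟙 A) (αmul : ∀ a b, α (a * b) = α b ≫ α a) (αadd : ∀ a b, α (a + b) = α a * α b)
    (hkerA : ∀ ⦃T : Over S⦄ (t : T ⟶ A), (∀ a ∈ 𝔭, t ≫ α a = 1) ↔ ∃ s : T ⟶ GA, s ≫ ιA = t)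
    {φ : GA ⟶ GB} (hφ : φ ≫ ιB = ιA ≫ ψ)
    {βK : O → (ker ψ ⟶ ker ψ)} (hβK : ∀ a, βK a ≫ kerι ψ = kerι ψ ≫ α a)
    {e : O} (he : e - 1 ∈ 𝔭) (hKe : ∀ a ∈ 𝔭, kerι ψ ≫ α (a * e) = 1) [IsFinite (ker ψ).hom] :
    IsFinite (ker φ).hom := by
  obtain ⟨E, -, -⟩ := exists_kerIso_fix ψ 𝔭 α ιA ιB α1 αmul αadd hkerA hφ hβK he hKe
  haveI := isFinite_fix_hom (βK e)
  exact isFinite_hom_of_iso E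

end Block

/-! ## §4 Over `Spec R`, affine carriers: the (O-K) ED. 2 and (SP-img) §3 instances for the layer map of the roof -/

section Affine

open Literature.AlgebraicGeometry.Motives AffineGroupScheme

variable {R : Type u} [CommRing R] {A B GA GB : SchemeOver R} [GrpObj A] [GrpObj B] [GrpObj GB] [IsAffine GA.left] [IsAffine GB.left]
  (ψ : A ⟶ B) [IsMonHom ψ] {O : Type*} [CommRing O] {σ : Type*} [SetLike σ O] (𝔭 : σ) (α : O → (A ⟶ A))
  (ιA : GA ⟶ A) [Mono ιA] (ιB : GB ⟶ B) [IsMonHom ιB] [Mono ιB]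

/-- **HEAD — THE ★ (O-K) ED. 2 INSTANCE FOR THE LAYER MAP OF A HOMOMORPHISM WHOSE KERNEL HAS A FLAT `𝔭`-BLOCK**: `Module.Flat R (Γ(A[𝔭]) ⧸ J(φ))` from
`[Flat (Ker ψ → Spec R)]`, the CRT element `e` (`e - 1 ∈ 𝔭`, `𝔭·e` kills `Ker ψ`) and the action preserved on `Ker ψ` (★ `flat_quotient_map_ker_counit_of_flat_ker`).
[cite: EGAIV2, Prop. 2.8.5] [cite: Tate1997FiniteFlatGroupSchemes, (3.7) p. 146] -/
theorem flat_quotient_map_ker_counit_of_block (α1 : α 1 = 𝟙 A) (αmul : ∀ a b, α (a * b) = α b ≫ α a) (αadd : ∀ a b, α (a + b) = α a * α b)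
    (hkerA : ∀ ⦃T : SchemeOver R⦄ (t : T ⟶ A), (∀ a ∈ 𝔭, t ≫ α a = 1) ↔ ∃ s : T ⟶ GA, s ≫ ιA = t)
    {φ : GA ⟶ GB} (hφ : φ ≫ ιB = ιA ≫ ψ)
    {βK : O → (ker ψ ⟶ ker ψ)} (hβK : ∀ a, βK a ≫ kerι ψ = kerι ψ ≫ α a)
    {e : O} (he : e - 1 ∈ 𝔭) (hKe : ∀ a ∈ 𝔭, kerι ψ ≫ α (a * e) = 1) [Flat (ker ψ).hom] :
    Module.Flat R (Alg GA ⧸ (RingHom.ker (Bialgebra.counitAlgHom R (Alg GB))).map (Alg.comap φ)) := by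
  haveI := flat_ker_hom_of_block ψ 𝔭 α ιA ιB α1 αmul αadd hkerA hφ hβK he hKe
  exact flat_quotient_map_ker_counit_of_flat_ker φ

/-- **HEAD — THE ★ (SP-img) §3 INSTANCE (FLAT COKERNEL) FOR THE SAME LAYER MAP** over a LOCAL `R` with `Γ(A[𝔭])` finite free, `φ` a homomorphism, `R → κ` a field killing `𝔪`,
`R ↪ K` a field (★ `ImageCokernelFlat.flat_quotient_range_comap_of_flat_quotient_map_ker_counit`). [cite: EGAIV2, Prop. 2.8.5] [cite: Tate1997FiniteFlatGroupSchemes, (3.7) p. 146] -/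
theorem flat_quotient_range_comap_of_block [IsLocalRing R] [GrpObj GA] (K κ : Type u) [Field K] [Algebra R K] [Field κ] [Algebra R κ]
    [IsAffine ((Over.pullback (Spec.map (CommRingCat.ofHom (algebraMap R K)))).obj GA).left]
    [IsAffine ((Over.pullback (Spec.map (CommRingCat.ofHom (algebraMap R κ)))).obj GA).left]
    [IsAffine ((Over.pullback (Spec.map (CommRingCat.ofHom (algebraMap R K)))).obj GB).left]
    [IsAffine ((Over.pullback (Spec.map (CommRingCat.ofHom (algebraMap R κ)))).obj GB).left]
    [Module.Finite R (Alg GA)] [Module.Free R (Alg GA)]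
    (α1 : α 1 = 𝟙 A) (αmul : ∀ a b, α (a * b) = α b ≫ α a) (αadd : ∀ a b, α (a + b) = α a * α b)
    (hkerA : ∀ ⦃T : SchemeOver R⦄ (t : T ⟶ A), (∀ a ∈ 𝔭, t ≫ α a = 1) ↔ ∃ s : T ⟶ GA, s ≫ ιA = t)
    {φ : GA ⟶ GB} [IsMonHom φ] (hφ : φ ≫ ιB = ιA ≫ ψ)
    {βK : O → (ker ψ ⟶ ker ψ)} (hβK : ∀ a, βK a ≫ kerι ψ = kerι ψ ≫ α a)
    {e : O} (he : e - 1 ∈ 𝔭) (hKe : ∀ a ∈ 𝔭, kerι ψ ≫ α (a * e) = 1) [Flat (ker ψ).hom]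
    (hκ : IsLocalRing.maximalIdeal R ≤ RingHom.ker (algebraMap R κ)) (hK : Function.Injective (algebraMap R K)) :
    Module.Flat R (Alg GA ⧸ LinearMap.range (Alg.comap φ).toLinearMap) := by
  haveI := flat_quotient_map_ker_counit_of_block ψ 𝔭 α ιA ιB α1 αmul αadd hkerA hφ hβK he hKe
  exact flat_quotient_range_comap_of_flat_quotient_map_ker_counit K κ φ hκ hK

end Affine

end Literature.AlgebraicGeometry.GroupSchemes.LayerMapKernel

end
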